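import Mathlib
import Literature.NumberTheory.LFunctions.WeilSemilocalCompactnessProofs
import Literature.NumberTheory.LFunctions.WeilWindowSimpleEven
import Literature.NumberTheory.LFunctions.WeilExplicitProofs
import HarnessLib

/-!
# Stub `stub_zeroLevelNullVector`, helper file 2/5: level sets, the lower Courant–Fischer bound, perturbation lemmas; `L²` bookkeeping
(item stmt-RiemannHypothesis-2064, route route-RiemannHypothesis-RuelleBand; registered stub
`stub_zeroLevelNullVector` of line `cofinite-weil-index-staircase` — "a zero min–max level of the
window form is a null vector", the attainment half of the crossing lemma).

Abstract Hilbert-space layer (`W` pre-Hilbert, `H` Hilbert, `T : W →L[ℂ] H`, form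
`q(x) = ‖x‖² - C‖T x‖²`). The inner level set of a core tuple `y : Fin (N+1) → W` is written out
verbatim as `{r | ∃ c, ‖T (Σ cᵢ yᵢ)‖² = 1 ∧ r = ‖Σ cᵢ yᵢ‖² - C ‖T (Σ cᵢ yᵢ)‖²}` (no definitions).

* `stub_zeroLevelNullVector_inner_nonempty_bddAbove`: for `T` injective and `y` linearly
  independent the inner level set is nonempty, bounded above, and `≥ -C`.
* `stub_zeroLevelNullVector_claimB`: the `≥` half of Courant–Fischer at level `N` over the core —
  an `(N+1)`-dimensional core span contains a `T`-unit vector orthogonal to `N` prescribed basis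
  vectors of the completion, where the diagonalised form is `≥ m` by Parseval.
* `stub_zeroLevelNullVector_form_perturb`, `stub_zeroLevelNullVector_form_span`: continuity of the
  form in the `W`-norm, and its value on spans of eigenvectors (used by the `≤` half, file 3/5).

Weil/`L²` layer (registered sub-goal `stub_zeroLevelNullVector_norm_toLp_sub_sq`): norms and
distances of `L²` classes `[g] = MemLp.toLp g` as integrals.

No definitions, no named facts. Reference: M. Reed, B. Simon, *Methods of Modern Mathematical
Physics IV*, Thm. XIII.1–2 (min–max over a form core).
-/

set_option linter.dupNamespace false -- justified: the module path repeats `RiemannHypothesis` (summit = problem); header prescribed by the line lead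

noncomputable section

open Complex MeasureTheory Filter Set
open scoped BigOperators Topology ComplexConjugate InnerProductSpace

namespace Summit.RiemannHypothesis.RiemannHypothesis.Theorems.RuelleBandCofiniteCriticalLine

open Literature.NumberTheory.LFunctions

section AbstractLayer

variable {W : Type*} [NormedAddCommGroup W] [InnerProductSpace ℂ W]
variable {H : Type*} [NormedAddCommGroup H] [InnerProductSpace ℂ H] [CompleteSpace H]

/-! ### The finite-span level sets -/

section Levels

omit [CompleteSpace H] in
/-- The trial map `c ↦ T (Σ cᵢ yᵢ)` is linear. [folklore] -/
theorem stub_zeroLevelNullVector_exists_linearMap (T : W →L[ℂ] H) {N : ℕ} (y : Fin (N + 1) → W) :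
    ∃ L : (Fin (N + 1) → ℂ) →ₗ[ℂ] H, ∀ c, L c = T (∑ i, c i • y i) := by
  classical
  refine ⟨(T : W →ₗ[ℂ] H) ∘ₗ
    ∑ i, (LinearMap.proj i : (Fin (N + 1) → ℂ) →ₗ[ℂ] ℂ).smulRight (y i), fun c => ?_⟩
  simp

omit [CompleteSpace H] in
/-- **The inner level set of a linearly independent tuple is nonempty and bounded above** (the
`T`-unit "ellipsoid" `{c | ‖T (Σ cᵢ yᵢ)‖ = 1}` is nonempty and bounded because `c ↦ T (Σ cᵢ yᵢ)` is an
injective linear map on a finite-dimensional space), and every level is `≥ -C`. [folklore] -/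
theorem stub_zeroLevelNullVector_inner_nonempty_bddAbove (T : W →L[ℂ] H) (C : ℝ) {N : ℕ}
    (hTinj : Function.Injective T) {y : Fin (N + 1) → W} (hy : LinearIndependent ℂ y) :
    ({r : ℝ | ∃ c : Fin (N + 1) → ℂ, ‖T (∑ i, c i • y i)‖ ^ 2 = 1 ∧
        r = ‖∑ i, c i • y i‖ ^ 2 - C * ‖T (∑ i, c i • y i)‖ ^ 2}).Nonempty ∧
    BddAbove {r : ℝ | ∃ c : Fin (N + 1) → ℂ, ‖T (∑ i, c i • y i)‖ ^ 2 = 1 ∧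
        r = ‖∑ i, c i • y i‖ ^ 2 - C * ‖T (∑ i, c i • y i)‖ ^ 2} ∧
    ∀ r ∈ {r : ℝ | ∃ c : Fin (N + 1) → ℂ, ‖T (∑ i, c i • y i)‖ ^ 2 = 1 ∧
        r = ‖∑ i, c i • y i‖ ^ 2 - C * ‖T (∑ i, c i • y i)‖ ^ 2}, -C ≤ r := by
  classical
  refine ⟨?_, ?_, ?_⟩
  · -- nonempty: normalise `y 0`
    have hy0 : y 0 ≠ 0 := hy.ne_zero 0
    have hTy0 : T (y 0) ≠ 0 := fun h => hy0 (hTinj (by rw [h, map_zero]))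
    set ρ : ℝ := ‖T (y 0)‖ with hρ
    have hρpos : 0 < ρ := norm_pos_iff.2 hTy0
    set c : Fin (N + 1) → ℂ := fun i => if i = 0 then ((ρ⁻¹ : ℝ) : ℂ) else 0 with hc
    have hsum : ∑ i, c i • y i = ((ρ⁻¹ : ℝ) : ℂ) • y 0 := by
      rw [Fintype.sum_eq_single 0 (fun i hi => by simp [hc, hi])]
      simp [hc]
    refine ⟨_, c, ?_, rfl⟩
    rw [hsum, map_smul, norm_smul, Complex.norm_real, Real.norm_of_nonneg (inv_nonneg.2 hρpos.le),
      ← hρ, inv_mul_cancel₀ hρpos.ne', one_pow]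
  · -- bounded above: the ellipsoid is bounded
    obtain ⟨L, hL⟩ := stub_zeroLevelNullVector_exists_linearMap T y
    have hker : LinearMap.ker L = ⊥ := by
      rw [LinearMap.ker_eq_bot']
      intro c hc0
      rw [hL] at hc0
      have h0 : ∑ i, c i • y i = 0 := hTinj (by rw [hc0, map_zero])
      funext i
      exact Fintype.linearIndependent_iff.1 hy c h0 i
    obtain ⟨Kc, -, hanti⟩ := L.exists_antilipschitzWith hker
    set B : ℝ := ∑ i : Fin (N + 1), (Kc : ℝ) * ‖y i‖ with hB
    refine ⟨B ^ 2 - C, ?_⟩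
    rintro r ⟨c, hc1, rfl⟩
    have hc1' : ‖T (∑ i, c i • y i)‖ = 1 := by
      have h := hc1
      rwa [pow_eq_one_iff_of_nonneg (norm_nonneg _) two_ne_zero] at h
    have hcle : ‖c‖ ≤ Kc := by
      have h := ZeroHomClass.bound_of_antilipschitz L hanti c
      rwa [hL, hc1', mul_one] at h
    have hnorm : ‖∑ i, c i • y i‖ ≤ B := by
      refine (norm_sum_le _ _).trans ?_
      rw [hB]
      refine Finset.sum_le_sum fun i _ => ?_
      rw [norm_smul]
      exact mul_le_mul_of_nonneg_right ((norm_le_pi_norm c i).trans hcle) (norm_nonneg _)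
    rw [hc1, mul_one]
    have hB0 : 0 ≤ B := (norm_nonneg _).trans hnorm
    nlinarith [norm_nonneg (∑ i, c i • y i)]
  · rintro r ⟨c, hc1, rfl⟩
    rw [hc1, mul_one]
    nlinarith [norm_nonneg (∑ i, c i • y i)]

end Levels

/-! ### The two halves of Courant–Fischer at level `N` over the core -/

section Claims

omit [CompleteSpace H] in
/-- **Lower bound (Courant–Fischer, `≥` half).** If off a set `I` of at most `N` indices the
levels satisfy `m κᵢ ≤ 1 - C κᵢ`, then every linearly independent `(N+1)`-tuple of the core spans a
`T`-unit vector orthogonal to `bᵢ`, `i ∈ I`, at which the form is `≥ m` (Parseval).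
(Reed–Simon IV, Thm. XIII.1–2.) [folklore] -/
theorem stub_zeroLevelNullVector_claimB (T : W →L[ℂ] H) (C : ℝ) {N : ℕ}
    (hTinj : Function.Injective T)
    (Th : UniformSpace.Completion W →L[ℂ] H) (hTh : ∀ x : W, Th x = T x)
    {s : Set (UniformSpace.Completion W)} (b : HilbertBasis s ℂ (UniformSpace.Completion W))
    (κ : s → ℝ)
    (hk5 : ∀ z, HasSum (fun i => κ i * ‖⟪b i, z⟫_ℂ‖ ^ 2) (‖Th z‖ ^ 2))
    (hk6 : ∀ z, HasSum (fun i => ‖⟪b i, z⟫_ℂ‖ ^ 2) (‖z‖ ^ 2))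
    (I : Finset s) (hI : I.card ≤ N) {m : ℝ} (hm : ∀ i, i ∉ I → m * κ i ≤ 1 - C * κ i)
    {y : Fin (N + 1) → W} (hy : LinearIndependent ℂ y) :
    ∃ r ∈ {r : ℝ | ∃ c : Fin (N + 1) → ℂ, ‖T (∑ i, c i • y i)‖ ^ 2 = 1 ∧
        r = ‖∑ i, c i • y i‖ ^ 2 - C * ‖T (∑ i, c i • y i)‖ ^ 2}, m ≤ r := by
  classical
  -- the trial map and the `I`-coefficient map
  set Sy : (Fin (N + 1) → ℂ) →ₗ[ℂ] W :=
    ∑ j, (LinearMap.proj j : (Fin (N + 1) → ℂ) →ₗ[ℂ] ℂ).smulRight (y j) with hSy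
  have hSy_apply : ∀ a, Sy a = ∑ j, a j • y j := fun a => by simp [hSy]
  set ιW : W →L[ℂ] UniformSpace.Completion W := UniformSpace.Completion.toComplL with hιW
  have hιW_apply : ∀ x : W, ιW x = (x : UniformSpace.Completion W) := fun x => rfl
  set L : (Fin (N + 1) → ℂ) →ₗ[ℂ] (I → ℂ) :=
    LinearMap.pi fun i : I =>
      ((innerSL ℂ ((b i : UniformSpace.Completion W))).toLinearMap ∘ₗ (ιW : W →ₗ[ℂ] _)) ∘ₗ Sy
    with hL
  have hL_apply : ∀ a (i : I), L a i = ⟪(b i : UniformSpace.Completion W),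
      ((∑ j, a j • y j : W) : UniformSpace.Completion W)⟫_ℂ := fun a i => by
    simp only [hL, LinearMap.pi_apply, LinearMap.coe_comp, Function.comp_apply,
      ContinuousLinearMap.coe_coe, innerSL_apply_apply, hSy_apply, hιW_apply]
  -- a non-zero coefficient vector in the kernel
  have hrank : Module.finrank ℂ (I → ℂ) < Module.finrank ℂ (Fin (N + 1) → ℂ) := by
    rw [Module.finrank_fintype_fun_eq_card, Module.finrank_fintype_fun_eq_card, Fintype.card_coe,
      Fintype.card_fin]
    omega
  obtain ⟨a, ha, ha0⟩ := (Submodule.ne_bot_iff _).1 (LinearMap.ker_ne_bot_of_finrank_lt hrank (f := L))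
  rw [LinearMap.mem_ker] at ha
  set x : W := ∑ j, a j • y j with hx
  have hx0 : x ≠ 0 := by
    intro h0
    apply ha0
    funext j
    exact Fintype.linearIndependent_iff.1 hy a h0 j
  have hTx0 : T x ≠ 0 := fun h => hx0 (hTinj (by rw [h, map_zero]))
  set ρ : ℝ := ‖T x‖ with hρ
  have hρpos : 0 < ρ := norm_pos_iff.2 hTx0
  set a' : Fin (N + 1) → ℂ := fun j => ((ρ⁻¹ : ℝ) : ℂ) * a j with ha'
  have hsum' : ∑ j, a' j • y j = ((ρ⁻¹ : ℝ) : ℂ) • x := by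
    simp only [ha', hx, mul_smul, Finset.smul_sum]
  have hT1 : ‖T (∑ j, a' j • y j)‖ = 1 := by
    rw [hsum', map_smul, norm_smul, Complex.norm_real, Real.norm_of_nonneg (inv_nonneg.2 hρpos.le),
      ← hρ, inv_mul_cancel₀ hρpos.ne']
  set z : UniformSpace.Completion W := ((∑ j, a' j • y j : W) : UniformSpace.Completion W) with hz
  have hThz : Th z = T (∑ j, a' j • y j) := hTh _
  have hzI : ∀ i ∈ I, ⟪(b i : UniformSpace.Completion W), z⟫_ℂ = 0 := fun i hi => by
    have h := congr_fun ha ⟨i, hi⟩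
    rw [hL_apply] at h
    simp only [Pi.zero_apply] at h
    rw [← hx] at h
    rw [hz, hsum', UniformSpace.Completion.coe_smul, inner_smul_right, h, mul_zero]
  refine ⟨‖∑ j, a' j • y j‖ ^ 2 - C * ‖T (∑ j, a' j • y j)‖ ^ 2, ⟨a', by rw [hT1, one_pow], rfl⟩,
    ?_⟩
  -- Parseval comparison
  have hnz : ‖∑ j, a' j • y j‖ = ‖z‖ := by rw [hz, UniformSpace.Completion.norm_coe]
  have hf : HasSum (fun i => (1 - C * κ i) * ‖⟪b i, z⟫_ℂ‖ ^ 2) (‖z‖ ^ 2 - C * ‖Th z‖ ^ 2) := by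
    have h := (hk6 z).sub ((hk5 z).mul_left C)
    refine h.congr_fun fun i => ?_
    ring
  have hg : HasSum (fun i => m * κ i * ‖⟪b i, z⟫_ℂ‖ ^ 2) (m * ‖Th z‖ ^ 2) := by
    have h := (hk5 z).mul_left m
    refine h.congr_fun fun i => ?_
    ring
  have hle : ∀ i, m * κ i * ‖⟪b i, z⟫_ℂ‖ ^ 2 ≤ (1 - C * κ i) * ‖⟪b i, z⟫_ℂ‖ ^ 2 := by
    intro i
    by_cases hi : i ∈ I
    · rw [hzI i hi, norm_zero, zero_pow two_ne_zero, mul_zero, mul_zero]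
    · exact mul_le_mul_of_nonneg_right (hm i hi) (sq_nonneg _)
  have hcomp := hasSum_le hle hg hf
  rw [hThz, hT1] at hcomp
  rw [hnz, ← hThz]
  rw [hThz, hT1]
  linarith


/-- Sup norm versus `ℓ²` sum on `Fin (N+1) → ℂ`: `‖a‖² ≤ Σ |aⱼ|²`. [folklore] -/
theorem stub_zeroLevelNullVector_pi_norm_sq_le {N : ℕ} (a : Fin (N + 1) → ℂ) :
    ‖a‖ ^ 2 ≤ ∑ j, ‖a j‖ ^ 2 := by
  set S : ℝ := ∑ j, ‖a j‖ ^ 2 with hS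
  have hS0 : 0 ≤ S := Finset.sum_nonneg fun j _ => sq_nonneg _
  have h1 : ‖a‖ ≤ Real.sqrt S := by
    refine (pi_norm_le_iff_of_nonneg (Real.sqrt_nonneg S)).2 fun j => ?_
    refine Real.le_sqrt_of_sq_le ?_
    exact Finset.single_le_sum (f := fun j => ‖a j‖ ^ 2) (fun j _ => sq_nonneg _)
      (Finset.mem_univ j)
  calc ‖a‖ ^ 2 ≤ Real.sqrt S ^ 2 := pow_le_pow_left₀ (norm_nonneg _) h1 2
    _ = S := Real.sq_sqrt hS0

/-- `‖Σ aⱼ vⱼ‖ ≤ (N+1) ‖a‖ R` when `‖vⱼ‖ ≤ R`. [folklore] -/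
theorem stub_zeroLevelNullVector_norm_sum_smul_le {E : Type*} [SeminormedAddCommGroup E]
    [NormedSpace ℂ E] {N : ℕ} (a : Fin (N + 1) → ℂ) (v : Fin (N + 1) → E) {R : ℝ}
    (hv : ∀ j, ‖v j‖ ≤ R) : ‖∑ j, a j • v j‖ ≤ ((N : ℝ) + 1) * ‖a‖ * R := by
  calc ‖∑ j, a j • v j‖ ≤ ∑ j, ‖a j • v j‖ := norm_sum_le _ _
    _ ≤ ∑ _j : Fin (N + 1), ‖a‖ * R := Finset.sum_le_sum fun j _ => by
        rw [norm_smul]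
        exact mul_le_mul (norm_le_pi_norm a j) (hv j) (norm_nonneg _) (norm_nonneg _)
    _ = ((N : ℝ) + 1) * ‖a‖ * R := by
        rw [Finset.sum_const, Finset.card_univ, Fintype.card_fin, nsmul_eq_mul]
        push_cast
        ring

/-- **Perturbation of the form `‖z‖² - C ‖Θ z‖²`**: if `‖z‖ ≤ M` and `‖z' - z‖ ≤ η M` with
`0 ≤ η ≤ 1`, then `‖z'‖² - C‖Θ z'‖² ≤ (‖z‖² - C‖Θ z‖²) + 3η (1 + |C| ‖Θ‖²) M²`. [folklore] -/
theorem stub_zeroLevelNullVector_form_perturb {E : Type*} [NormedAddCommGroup E] [NormedSpace ℂ E]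
    {F : Type*} [NormedAddCommGroup F] [NormedSpace ℂ F] (Θ : E →L[ℂ] F) (C : ℝ) {z z' : E} {M η : ℝ} (hM : 0 ≤ M) (hη : 0 ≤ η)
    (hη1 : η ≤ 1) (hz : ‖z‖ ≤ M) (hd : ‖z' - z‖ ≤ η * M) :
    ‖z'‖ ^ 2 - C * ‖Θ z'‖ ^ 2 ≤
      (‖z‖ ^ 2 - C * ‖Θ z‖ ^ 2) + 3 * η * (1 + |C| * ‖Θ‖ ^ 2) * M ^ 2 := by
  have hηM : 0 ≤ η * M := mul_nonneg hη hM
  have hz'1 : ‖z'‖ ≤ ‖z‖ + η * M := by linarith [norm_sub_norm_le z' z]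
  have hz'_le : ‖z'‖ ≤ 2 * M := by nlinarith
  -- `‖z'‖² ≤ ‖z‖² + 3 η M²`
  have hsq1 : ‖z'‖ ^ 2 ≤ ‖z‖ ^ 2 + 3 * η * M ^ 2 := by
    have h3 : ‖z'‖ ^ 2 ≤ (‖z‖ + η * M) ^ 2 := pow_le_pow_left₀ (norm_nonneg _) hz'1 2
    have h5 : η * M * ‖z‖ ≤ η * M * M := mul_le_mul_of_nonneg_left hz hηM
    have h6 : η * η ≤ η := by nlinarith
    have h7 : (η * M) ^ 2 ≤ η * M ^ 2 := by
      have := mul_le_mul_of_nonneg_right h6 (sq_nonneg M)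
      nlinarith
    nlinarith
  -- `|‖Θ z'‖² - ‖Θ z‖²| ≤ 3 η ‖Θ‖² M²`
  have habs : |‖Θ z'‖ ^ 2 - ‖Θ z‖ ^ 2| ≤ 3 * η * ‖Θ‖ ^ 2 * M ^ 2 := by
    have h1 : |‖Θ z'‖ - ‖Θ z‖| ≤ ‖Θ‖ * (η * M) := by
      refine (abs_norm_sub_norm_le _ _).trans ?_
      rw [← map_sub]
      exact (Θ.le_opNorm _).trans (mul_le_mul_of_nonneg_left hd (norm_nonneg _))
    have h2 : ‖Θ z'‖ + ‖Θ z‖ ≤ ‖Θ‖ * (3 * M) := by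
      have h3 : ‖Θ z'‖ ≤ ‖Θ‖ * (2 * M) :=
        (Θ.le_opNorm _).trans (mul_le_mul_of_nonneg_left hz'_le (norm_nonneg _))
      have h4 : ‖Θ z‖ ≤ ‖Θ‖ * M :=
        (Θ.le_opNorm _).trans (mul_le_mul_of_nonneg_left hz (norm_nonneg _))
      linarith
    rw [sq_sub_sq, abs_mul, abs_of_nonneg (by positivity : 0 ≤ ‖Θ z'‖ + ‖Θ z‖)]
    calc (‖Θ z'‖ + ‖Θ z‖) * |‖Θ z'‖ - ‖Θ z‖|
        ≤ (‖Θ‖ * (3 * M)) * (‖Θ‖ * (η * M)) :=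
          mul_le_mul h2 h1 (abs_nonneg _) (by positivity)
      _ = 3 * η * ‖Θ‖ ^ 2 * M ^ 2 := by ring
  have hC : -C * ‖Θ z'‖ ^ 2 ≤ -C * ‖Θ z‖ ^ 2 + |C| * (3 * η * ‖Θ‖ ^ 2 * M ^ 2) := by
    have h1 : -C * (‖Θ z'‖ ^ 2 - ‖Θ z‖ ^ 2) ≤ |C| * (3 * η * ‖Θ‖ ^ 2 * M ^ 2) :=
      calc -C * (‖Θ z'‖ ^ 2 - ‖Θ z‖ ^ 2) ≤ |-C * (‖Θ z'‖ ^ 2 - ‖Θ z‖ ^ 2)| := le_abs_self _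
        _ = |C| * |‖Θ z'‖ ^ 2 - ‖Θ z‖ ^ 2| := by rw [abs_mul, abs_neg]
        _ ≤ |C| * (3 * η * ‖Θ‖ ^ 2 * M ^ 2) := mul_le_mul_of_nonneg_left habs (abs_nonneg C)
    linarith
  have hring : 3 * η * (1 + |C| * ‖Θ‖ ^ 2) * M ^ 2 =
      3 * η * M ^ 2 + |C| * (3 * η * ‖Θ‖ ^ 2 * M ^ 2) := by ring
  linarith

omit [CompleteSpace H] in
/-- **The form on the span of finitely many eigenvectors**: for an orthonormal family `u` with
`⟪Θ uⱼ, Θ w⟫ = κⱼ ⟪uⱼ, w⟫`, `‖Σ aⱼuⱼ‖² - C ‖Θ (Σ aⱼuⱼ)‖² = Σ (1 - C κⱼ) |aⱼ|²`. [folklore] -/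
theorem stub_zeroLevelNullVector_form_span {E : Type*} [NormedAddCommGroup E]
    [InnerProductSpace ℂ E] (Θ : E →L[ℂ] H) (C : ℝ) {N : ℕ} {u : Fin (N + 1) → E}
    (hu : Orthonormal ℂ u) {κ : Fin (N + 1) → ℝ}
    (hk : ∀ j w, ⟪Θ (u j), Θ w⟫_ℂ = (κ j : ℂ) * ⟪u j, w⟫_ℂ) (a : Fin (N + 1) → ℂ) :
    ‖∑ j, a j • u j‖ ^ 2 - C * ‖Θ (∑ j, a j • u j)‖ ^ 2 = ∑ j, (1 - C * κ j) * ‖a j‖ ^ 2 := by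
  have hnormz : ‖∑ j, a j • u j‖ ^ 2 = ∑ j, ‖a j‖ ^ 2 := by
    rw [← inner_self_eq_norm_sq (𝕜 := ℂ), hu.inner_sum a a Finset.univ, map_sum]
    refine Finset.sum_congr rfl fun j _ => ?_
    rw [RCLike.conj_mul, ← RCLike.ofReal_pow, RCLike.ofReal_re]
  have hleft : ∀ w, ⟪Θ (∑ j, a j • u j), Θ w⟫_ℂ = ∑ j, conj (a j) * ((κ j : ℂ) * ⟪u j, w⟫_ℂ) := by
    intro w
    rw [map_sum, sum_inner]
    refine Finset.sum_congr rfl fun j _ => ?_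
    rw [map_smul, inner_smul_left, hk]
  have hnormTz : ‖Θ (∑ j, a j • u j)‖ ^ 2 = ∑ j, κ j * ‖a j‖ ^ 2 := by
    rw [← inner_self_eq_norm_sq (𝕜 := ℂ), hleft, map_sum]
    refine Finset.sum_congr rfl fun j _ => ?_
    rw [hu.inner_right_fintype]
    have h2 : conj (a j) * ((κ j : ℂ) * a j) = ((κ j * ‖a j‖ ^ 2 : ℝ) : ℂ) := by
      push_cast
      rw [← Complex.conj_mul']
      ring
    rw [h2, RCLike.re_to_complex, Complex.ofReal_re]
  rw [hnormz, hnormTz, Finset.mul_sum, ← Finset.sum_sub_distrib]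
  refine Finset.sum_congr rfl fun j _ => ?_
  ring

end Claims

end AbstractLayer

/-! ### `L²` bookkeeping for test functions -/

section L2

/-- `‖[g]‖² = ∫ ‖g‖²` for the `L²` class of a square-integrable `g`. [folklore] -/
theorem stub_zeroLevelNullVector_norm_toLp_sq {g : ℝ → ℂ} (hg : MemLp g 2 volume) :
    ‖hg.toLp g‖ ^ 2 = ∫ t, ‖g t‖ ^ 2 := by
  rw [Lp.norm_toLp, eLpNorm_two_eq_ofReal_sqrt hg, ENNReal.toReal_ofReal (Real.sqrt_nonneg _),
    Real.sq_sqrt (integral_nonneg fun t => by positivity)]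

/-- `dist ([g], v) = √(∫ ‖g - v‖²)` in `L²`. [folklore] -/
theorem stub_zeroLevelNullVector_dist_toLp {g : ℝ → ℂ} (hg : MemLp g 2 volume)
    (v : Lp ℂ 2 (volume : Measure ℝ)) :
    dist (hg.toLp g) v = Real.sqrt (∫ t, ‖g t - v t‖ ^ 2) := by
  rw [Lp.dist_def, eLpNorm_congr_ae (hg.coeFn_toLp.sub EventuallyEq.rfl),
    eLpNorm_two_eq_ofReal_sqrt (hg.sub (Lp.memLp v)), ENNReal.toReal_ofReal (Real.sqrt_nonneg _)]
  rfl

/-- `‖[g] - [h]‖² = ∫ ‖g - h‖²` in `L²`. [folklore] -/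
theorem stub_zeroLevelNullVector_norm_toLp_sub_sq :
    ∀ {g h : ℝ → ℂ} (hg : MemLp g 2 volume) (hh : MemLp h 2 volume),
      ‖hg.toLp g - hh.toLp h‖ ^ 2 = ∫ t, ‖g t - h t‖ ^ 2 := by
  intro g h hg hh
  rw [← MemLp.toLp_sub hg hh, stub_zeroLevelNullVector_norm_toLp_sq (hg.sub hh)]
  rfl

end L2

end Summit.RiemannHypothesis.RiemannHypothesis.Theorems.RuelleBandCofiniteCriticalLine

end
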